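import Summits.CriticalPhenomena.Ising3D.ExclusionSentencesKacx

/-!
# Census variants of the `KAC` / `KACX` table checkers, and index witnesses (cell `pub-ising3x`, recog-1)

HONEST FRAMING: lottery ticket; floor = tightest certified 3D Ising CFT bounds; no exact-solution
claim without a proof.

`ExclusionSentences.lean` / `ExclusionSentencesKacx.lean` decide sentences of the form «every member of
the table in `[a, b]` is in the exception list `ex`» by scanning the whole table and, for each member in
the window, scanning `ex`. For an EXCLUSION sentence `ex` has a handful of entries; for a CENSUS (the
complete member list of a window, paper §7.3: hundreds of entries) the inner scan dominates the kernel
cost (measured: `×8` on the 509-entry `KACX` list of the certified segment). This module provides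
* `denFilter D ex` — the sub-list of `ex` whose entries `q` satisfy `q.den ∣ q.num · D`, a condition
  implied by `q = X / D` through the checkers' cross-multiplication test, so filtering by it once per
  table block (fixed denominator `D`) loses nothing and leaves a few entries per block;
* `kacExcludedC`, `n1ExcludedC`, `su2ExcludedC`, `zkExcludedC`, `w3ExcludedPPC` — the checkers of the two
  files with that prefilter inserted per block, each with a soundness theorem of the SAME statement shape
  as the original (`…_sound`: checker `= true` ⇒ every family member in `[a, b]` is in `ex`), and
  `kacxC_sound` assembling the four `KACX` tables exactly as `kacx_sound`;
* membership witnesses for the converse direction of a census: `mem_kacFamily_of_witnesses` (index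
  tuples `(p, p′, r, s, n)`), and for `KACX` the index type `KacxIndex` (table, indices, `h`/`2h` flag) with
  `KacxIndex.value`, `KacxIndex.adm`, `KacxIndex.value_mem_kacxFamily`, `mem_kacxFamily_of_witnesses`.
Nothing here mentions a window, a certificate or a datum; the census modules
`IsingColumnFaceL11Census{,Kacx}.lean` instantiate it. [folklore]
lottery ticket; floor = tightest certified 3D Ising CFT bounds; no exact-solution claim without a proof.
-/

namespace Summit.CriticalPhenomena.Ising3D

open Literature.MathematicalPhysics.QuantumFieldTheory.ConformalBootstrap3D

/-! ### The denominator prefilter -/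

/-- The entries `q` of `ex` with `q.den ∣ q.num · D`. If a table value `X / D` equals `q` then
`X · q.den = q.num · D`, so `q` passes; hence replacing `ex` by `denFilter D ex` inside a block of
denominator `D` changes no verdict, while the inner scans shrink to the few entries whose reduced
denominator is compatible with `D`. [folklore] -/
def denFilter (D : ℕ) (ex : List ℚ) : List ℚ :=
  ex.filter fun q => (q.num * (D : ℤ)) % (q.den : ℤ) == 0

/-- `denFilter D ex` is a sub-list of `ex`. [folklore] -/
theorem mem_of_mem_denFilter {D : ℕ} {ex : List ℚ} {q : ℚ} (h : q ∈ denFilter D ex) : q ∈ ex :=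
  (List.mem_filter.mp h).1

/-! ### `KAC` (Virasoro Kac table) census checker -/

/-- `kacCore` with the exception list prefiltered per `(p, p′)` block (`D = 2 p p′`); rational
exception list. [folklore] -/
def kacCoreC (N nmax : ℕ) (an : ℤ) (ad : ℕ) (bn : ℤ) (bd : ℕ) (ex : List ℚ) : Bool :=
  (List.range' 3 (N - 2)).all fun p' =>
    (List.range' 2 (p' - 2)).all fun p =>
      if Nat.Coprime p p' then
        let exD := exZ (denFilter (2 * p * p') ex)
        (List.range' 1 (p - 1)).all fun r =>
          (List.range' 1 (p' - 1)).all fun s =>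
            allIntIcc (max 0 (kacNLo an ad p p' r s)) (min (nmax : ℤ) (kacNHi bn bd p p' r s))
              fun n => exD.any fun e =>
                decide ((kacNum p p' r s + ((2 * p * p' : ℕ) : ℤ) * n) * (e.2 : ℤ) =
                  e.1 * ((2 * p * p' : ℕ) : ℤ))
      else true

/-- Census variant of `kacExcluded` (same verdicts, cost independent of `ex.length`). [folklore] -/
def kacExcludedC (N nmax : ℕ) (a b : ℚ) (ex : List ℚ) : Bool :=
  kacCoreC N nmax a.num a.den b.num b.den ex

/-- **Soundness of `kacExcludedC`** (statement shape of `kacExcluded_sound`): if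
`kacExcludedC N nmax a b ex = true` then every `v ∈ kacFamily N nmax` with `a ≤ v ≤ b` belongs to `ex`.
[folklore] -/
theorem kacExcludedC_sound {N nmax : ℕ} {a b : ℚ} {ex : List ℚ}
    (h : kacExcludedC N nmax a b ex = true) {v : ℚ} (hv : v ∈ kacFamily N nmax) (ha : a ≤ v)
    (hb : v ≤ b) : v ∈ ex := by
  simp only [kacFamily, Set.mem_setOf_eq] at hv
  obtain ⟨p, p', r, s, n, hp, hpp, hN, hcop, hr1, hr, hs1, hs, hn, rfl⟩ := hv
  have hD : 0 < 2 * p * p' := Nat.mul_pos (Nat.mul_pos (by norm_num) (by omega)) (by omega)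
  unfold kacExcludedC kacCoreC at h
  have h1 := List.all_eq_true.mp h p' (List.mem_range'_1.mpr ⟨by omega, by omega⟩)
  have h2 := List.all_eq_true.mp h1 p (List.mem_range'_1.mpr ⟨hp, by omega⟩)
  rw [if_pos hcop] at h2
  have h3 := List.all_eq_true.mp h2 r (List.mem_range'_1.mpr ⟨hr1, by omega⟩)
  have h4 := List.all_eq_true.mp h3 s (List.mem_range'_1.mpr ⟨hs1, by omega⟩)
  have ha' := (le_intDiv_iff a _ hD).mp ha
  have hb' := (intDiv_le_iff b _ hD).mp hb
  have hlo : max 0 (kacNLo a.num a.den p p' r s) ≤ (n : ℤ) :=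
    max_le (Int.natCast_nonneg n) (kacNLo_le a.den_pos hD ha')
  have hhi : (n : ℤ) ≤ min (nmax : ℤ) (kacNHi b.num b.den p p' r s) :=
    le_min (by exact_mod_cast hn) (le_kacNHi b.den_pos hD hb')
  have h5 := allIntIcc_sound h4 hlo hhi
  obtain ⟨e, he, hdec⟩ := List.any_eq_true.mp h5
  rw [decide_eq_true_eq] at hdec
  unfold exZ at he
  rw [List.mem_map] at he
  obtain ⟨q, hq, rfl⟩ := he
  have : kacValue p p' r s n = q := intDiv_eq_of_cross q _ hD hdec
  exact this ▸ mem_of_mem_denFilter hq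

/-! ### `KACX` (extended tables) census checkers -/

/-- `su2Core` with the prefilter per `k` block (`D = 4(k+2)`). [folklore] -/
def su2CoreC (S : ℕ) (an : ℤ) (ad : ℕ) (bn : ℤ) (bd : ℕ) (ex : List ℚ) : Bool :=
  (List.range' 1 (S - 2)).all fun k =>
    let exD := exZ (denFilter (4 * (k + 2)) ex)
    (List.range' 1 k).all fun tj => hPairCheck ((tj * (tj + 2) : ℕ) : ℤ) (4 * (k + 2)) an ad bn bd exD

/-- `zkCore` with the prefilter per `k` block (`D = 4k(k+2)`). [folklore] -/
def zkCoreC (S : ℕ) (an : ℤ) (ad : ℕ) (bn : ℤ) (bd : ℕ) (ex : List ℚ) : Bool :=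
  (List.range' 2 (S - 3)).all fun k =>
    let exD := exZ (denFilter (4 * k * (k + 2)) ex)
    (List.range (k + 1)).all fun l =>
      allIntIcc (-(2 * k : ℤ) + l + 1) (2 * k - l) fun m =>
        !decide (Even ((l : ℤ) - m)) || hPairCheck (zkNum k l m) (4 * k * (k + 2)) an ad bn bd exD

/-- `n1Core` with the prefilter per `(p, p′)` block (`D = 16 p p′`). [folklore] -/
def n1CoreC (S : ℕ) (an : ℤ) (ad : ℕ) (bn : ℤ) (bd : ℕ) (ex : List ℚ) : Bool :=
  (List.range' 3 (S - 2)).all fun pp =>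
    (List.range' 2 (pp - 2)).all fun p =>
      !n1Admissible p pp ||
        (let exD := exZ (denFilter (16 * p * pp) ex)
        (List.range' 1 (p - 1)).all fun r =>
          (List.range' 1 (pp - 1)).all fun s => hPairCheck (n1Num p pp r s) (16 * p * pp) an ad bn bd exD)

/-- `w3CorePP` with the prefilter per `(p, p′)` block (`D = 3 p p′`). [folklore] -/
def w3CorePPC (pp : ℕ) (an : ℤ) (ad : ℕ) (bn : ℤ) (bd : ℕ) (ex : List ℚ) : Bool :=
  (List.range' 3 (pp - 3)).all fun p =>
    !decide (Nat.Coprime p pp) ||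
      (let exD := exZ (denFilter (3 * p * pp) ex)
      (List.range' 1 (p - 2)).all fun n₁ =>
        (List.range' 1 (p - 1 - n₁)).all fun n₂ =>
          (List.range' 1 (pp - 2)).all fun m₁ =>
            (List.range' 1 (pp - 1 - m₁)).all fun m₂ =>
              hPairCheck (w3Num p pp n₁ n₂ m₁ m₂) (3 * p * pp) an ad bn bd exD)

/-- Rational interfaces of the census checkers (cf. `su2Excluded` etc.). [folklore] -/
def su2ExcludedC (S : ℕ) (a b : ℚ) (ex : List ℚ) : Bool := su2CoreC S a.num a.den b.num b.den ex

/-- See `su2ExcludedC`. [folklore] -/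
def zkExcludedC (S : ℕ) (a b : ℚ) (ex : List ℚ) : Bool := zkCoreC S a.num a.den b.num b.den ex

/-- See `su2ExcludedC`. [folklore] -/
def n1ExcludedC (S : ℕ) (a b : ℚ) (ex : List ℚ) : Bool := n1CoreC S a.num a.den b.num b.den ex

/-- See `su2ExcludedC`; one level `p′` per call as `w3ExcludedPP`. [folklore] -/
def w3ExcludedPPC (pp : ℕ) (a b : ℚ) (ex : List ℚ) : Bool := w3CorePPC pp a.num a.den b.num b.den ex

/-- Soundness of `su2ExcludedC` (shape of `su2Core_sound`). [folklore] -/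
theorem su2ExcludedC_sound {S : ℕ} {a b : ℚ} {ex : List ℚ} (h : su2ExcludedC S a b ex = true) {v : ℚ}
    (hv : v ∈ su2Family S) (ha : a ≤ v) (hb : v ≤ b) : v ∈ ex := by
  simp only [su2Family, Set.mem_setOf_eq] at hv
  obtain ⟨k, tj, hk, hkS, htj, htjk, hpos, hv⟩ := hv
  unfold su2ExcludedC su2CoreC at h
  have h1 := List.all_eq_true.mp h k (List.mem_range'_1.mpr ⟨hk, by omega⟩)
  have h2 := List.all_eq_true.mp h1 tj (List.mem_range'_1.mpr ⟨htj, by omega⟩)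
  exact mem_of_mem_denFilter (hPairCheck_sound (by positivity) h2 hpos hv ha hb)

/-- Soundness of `zkExcludedC` (shape of `zkCore_sound`). [folklore] -/
theorem zkExcludedC_sound {S : ℕ} {a b : ℚ} {ex : List ℚ} (h : zkExcludedC S a b ex = true) {v : ℚ}
    (hv : v ∈ zkFamily S) (ha : a ≤ v) (hb : v ≤ b) : v ∈ ex := by
  simp only [zkFamily, Set.mem_setOf_eq] at hv
  obtain ⟨k, l, m, hk, hkS, hl, hm1, hm2, hpar, hpos, hv⟩ := hv
  unfold zkExcludedC zkCoreC at h
  have h1 := List.all_eq_true.mp h k (List.mem_range'_1.mpr ⟨hk, by omega⟩)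
  have h2 := List.all_eq_true.mp h1 l (List.mem_range.mpr (by omega))
  have h3 := allIntIcc_sound h2 hm1 hm2
  rw [Bool.or_eq_true] at h3
  rcases h3 with h3 | h3
  · simp [hpar] at h3
  · exact mem_of_mem_denFilter (hPairCheck_sound (by positivity) h3 hpos hv ha hb)

/-- Soundness of `n1ExcludedC` (shape of `n1Core_sound`). [folklore] -/
theorem n1ExcludedC_sound {S : ℕ} {a b : ℚ} {ex : List ℚ} (h : n1ExcludedC S a b ex = true) {v : ℚ}
    (hv : v ∈ n1Family S) (ha : a ≤ v) (hb : v ≤ b) : v ∈ ex := by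
  simp only [n1Family, Set.mem_setOf_eq] at hv
  obtain ⟨p, pp, r, s, hp, hppp, hS, hadm, hr1, hr, hs1, hs, hpos, hv⟩ := hv
  unfold n1ExcludedC n1CoreC at h
  have h1 := List.all_eq_true.mp h pp (List.mem_range'_1.mpr ⟨by omega, by omega⟩)
  have h2 := List.all_eq_true.mp h1 p (List.mem_range'_1.mpr ⟨hp, by omega⟩)
  rw [Bool.or_eq_true] at h2
  rcases h2 with h2 | h2
  · simp [hadm] at h2
  · have h3 := List.all_eq_true.mp h2 r (List.mem_range'_1.mpr ⟨hr1, by omega⟩)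
    have h4 := List.all_eq_true.mp h3 s (List.mem_range'_1.mpr ⟨hs1, by omega⟩)
    have hD : 0 < 16 * p * pp := Nat.mul_pos (Nat.mul_pos (by norm_num) (by omega)) (by omega)
    exact mem_of_mem_denFilter (hPairCheck_sound hD h4 hpos hv ha hb)

/-- Soundness of the `W₃` census checkers (shape of `w3_sound`). [folklore] -/
theorem w3C_sound {S : ℕ} {a b : ℚ} {ex : List ℚ}
    (h : ∀ pp : ℕ, 4 ≤ pp → pp ≤ S → w3ExcludedPPC pp a b ex = true) {v : ℚ} (hv : v ∈ w3Family S)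
    (ha : a ≤ v) (hb : v ≤ b) : v ∈ ex := by
  simp only [w3Family, Set.mem_setOf_eq] at hv
  obtain ⟨p, pp, n₁, n₂, m₁, m₂, hp, hppp, hS, hcop, hn1, hn2, hn, hm1, hm2, hm, hpos, hv⟩ := hv
  have h0 := h pp (by omega) hS
  unfold w3ExcludedPPC w3CorePPC at h0
  have h1 := List.all_eq_true.mp h0 p (List.mem_range'_1.mpr ⟨hp, by omega⟩)
  rw [Bool.or_eq_true] at h1
  rcases h1 with h1 | h1
  · simp [hcop] at h1
  · have h2 := List.all_eq_true.mp h1 n₁ (List.mem_range'_1.mpr ⟨hn1, by omega⟩)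
    have h3 := List.all_eq_true.mp h2 n₂ (List.mem_range'_1.mpr ⟨hn2, by omega⟩)
    have h4 := List.all_eq_true.mp h3 m₁ (List.mem_range'_1.mpr ⟨hm1, by omega⟩)
    have h5 := List.all_eq_true.mp h4 m₂ (List.mem_range'_1.mpr ⟨hm2, by omega⟩)
    have hD : 0 < 3 * p * pp := Nat.mul_pos (Nat.mul_pos (by norm_num) (by omega)) (by omega)
    exact mem_of_mem_denFilter (hPairCheck_sound hD h5 hpos hv ha hb)

/-- **Soundness of the `KACX` census** (shape of `kacx_sound`): the four census checkers at the frozen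
sizes `= true` ⇒ every member of `kacxFamily` in `[a, b]` is in `ex`. [folklore] -/
theorem kacxC_sound {a b : ℚ} {ex : List ℚ} (hN1 : n1ExcludedC 24 a b ex = true)
    (hW3 : ∀ pp : ℕ, 4 ≤ pp → pp ≤ 16 → w3ExcludedPPC pp a b ex = true)
    (hSU2 : su2ExcludedC 40 a b ex = true) (hZK : zkExcludedC 40 a b ex = true) {v : ℚ}
    (hv : v ∈ kacxFamily) (ha : a ≤ v) (hb : v ≤ b) : v ∈ ex := by
  unfold kacxFamily at hv
  rcases hv with ((hv | hv) | hv) | hv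
  · exact n1ExcludedC_sound hN1 hv ha hb
  · exact w3C_sound hW3 hv ha hb
  · exact su2ExcludedC_sound hSU2 hv ha hb
  · exact zkExcludedC_sound hZK hv ha hb

/-! ### Index witnesses for the membership direction of a census -/

/-- Membership in the `KAC` table from the index ranges (the family's definition, repackaged).
[folklore] -/
theorem kacValue_mem_kacFamily' {N nmax p p' r s n : ℕ}
    (hk : 2 ≤ p ∧ p < p' ∧ p' ≤ N ∧ Nat.Coprime p p' ∧ 1 ≤ r ∧ r < p ∧ 1 ≤ s ∧ s < p' ∧ n ≤ nmax) :
    kacValue p p' r s n ∈ kacFamily N nmax :=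
  ⟨p, p', r, s, n, hk.1, hk.2.1, hk.2.2.1, hk.2.2.2.1, hk.2.2.2.2.1, hk.2.2.2.2.2.1, hk.2.2.2.2.2.2.1,
    hk.2.2.2.2.2.2.2.1, hk.2.2.2.2.2.2.2.2, rfl⟩

/-- Index witnesses certify `KAC` membership of a whole list: if `W.map (2h + n) = L` and every index tuple
`(p, p′, r, s, n)` of `W` lies in the table's ranges, every entry of `L` is in `kacFamily N nmax`.
[folklore] -/
theorem mem_kacFamily_of_witnesses (N nmax : ℕ) (L : List ℚ) (W : List (ℕ × ℕ × ℕ × ℕ × ℕ))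
    (hmap : W.map (fun w => kacValue w.1 w.2.1 w.2.2.1 w.2.2.2.1 w.2.2.2.2) = L)
    (hadm : (W.all fun w => decide (2 ≤ w.1 ∧ w.1 < w.2.1 ∧ w.2.1 ≤ N ∧ Nat.Coprime w.1 w.2.1 ∧
      1 ≤ w.2.2.1 ∧ w.2.2.1 < w.1 ∧ 1 ≤ w.2.2.2.1 ∧ w.2.2.2.1 < w.2.1 ∧ w.2.2.2.2 ≤ nmax)) = true) :
    ∀ v ∈ L, v ∈ kacFamily N nmax := by
  intro v hv
  rw [← hmap, List.mem_map] at hv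
  obtain ⟨w, hw, rfl⟩ := hv
  exact kacValue_mem_kacFamily' (of_decide_eq_true (List.all_eq_true.mp hadm w hw))

/-- An index into one of the four frozen `KACX` tables, with the flag `twice` selecting the member `2h`
(else `h`): `su2 k tj` = `h_j(SU(2)_k)`, `2j = tj`; `zk k l m` = `h_{l,m}(ℤ_k)`; `n1 p p′ r s` =
`h_{r,s}(SM(p,p′))`; `w3 p p′ n₁ n₂ m₁ m₂` = `h_{n₁n₂;m₁m₂}(W₃(p,p′))`. A bookkeeping type. [folklore] -/
inductive KacxIndex
  | su2 (k tj : ℕ) (twice : Bool)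
  | zk (k l : ℕ) (m : ℤ) (twice : Bool)
  | n1 (p pp r s : ℕ) (twice : Bool)
  | w3 (p pp n₁ n₂ m₁ m₂ : ℕ) (twice : Bool)

/-- The catalogue value an index points at: the table weight `h`, or `2h` when `twice`. [folklore] -/
def KacxIndex.value : KacxIndex → ℚ
  | su2 k tj twice => (if twice then 2 else 1) * su2Weight k tj
  | zk k l m twice => (if twice then 2 else 1) * zkWeight k l m
  | n1 p pp r s twice => (if twice then 2 else 1) * n1Weight p pp r s
  | w3 p pp n₁ n₂ m₁ m₂ twice => (if twice then 2 else 1) * w3Weight p pp n₁ n₂ m₁ m₂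

/-- Admissibility of an index: exactly the ranges of `su2Family 40`, `zkFamily 40`, `n1Family 24`,
`w3Family 16` (the frozen sizes of `kacxFamily`) together with `h > 0`, as one `Bool`. [folklore] -/
def KacxIndex.adm : KacxIndex → Bool
  | su2 k tj _ => decide (1 ≤ k ∧ k + 2 ≤ 40 ∧ 1 ≤ tj ∧ tj ≤ k ∧ 0 < su2Weight k tj)
  | zk k l m _ => decide (2 ≤ k ∧ k + 2 ≤ 40 ∧ l ≤ k ∧ -(2 * k : ℤ) + l + 1 ≤ m ∧ m ≤ 2 * k - l ∧
      Even ((l : ℤ) - m) ∧ 0 < zkWeight k l m)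
  | n1 p pp r s _ => decide (2 ≤ p ∧ p < pp ∧ pp ≤ 24 ∧ n1Admissible p pp = true ∧ 1 ≤ r ∧ r < p ∧
      1 ≤ s ∧ s < pp ∧ 0 < n1Weight p pp r s)
  | w3 p pp n₁ n₂ m₁ m₂ _ => decide (3 ≤ p ∧ p < pp ∧ pp ≤ 16 ∧ Nat.Coprime p pp ∧ 1 ≤ n₁ ∧ 1 ≤ n₂ ∧
      n₁ + n₂ ≤ p - 1 ∧ 1 ≤ m₁ ∧ 1 ≤ m₂ ∧ m₁ + m₂ ≤ pp - 1 ∧ 0 < w3Weight p pp n₁ n₂ m₁ m₂)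

/-- `(if twice then 2 else 1) * h` is `h` or `2 h`. [folklore] -/
theorem ite_mul_eq_or (twice : Bool) (h : ℚ) :
    (if twice then 2 else 1) * h = h ∨ (if twice then 2 else 1) * h = 2 * h := by
  cases twice <;> simp

/-- **An admissible index points at a member of `kacxFamily`** (the family's definition, repackaged).
[folklore] -/
theorem KacxIndex.value_mem_kacxFamily (w : KacxIndex) (hw : w.adm = true) : w.value ∈ kacxFamily := by
  cases w with
  | su2 k tj twice =>
    simp only [KacxIndex.adm, decide_eq_true_eq] at hw
    obtain ⟨hk, hkS, htj, htjk, hpos⟩ := hw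
    exact Or.inl (Or.inr ⟨k, tj, hk, hkS, htj, htjk, hpos, ite_mul_eq_or twice _⟩)
  | zk k l m twice =>
    simp only [KacxIndex.adm, decide_eq_true_eq] at hw
    obtain ⟨hk, hkS, hl, hm1, hm2, hpar, hpos⟩ := hw
    exact Or.inr ⟨k, l, m, hk, hkS, hl, hm1, hm2, hpar, hpos, ite_mul_eq_or twice _⟩
  | n1 p pp r s twice =>
    simp only [KacxIndex.adm, decide_eq_true_eq] at hw
    obtain ⟨hp, hppp, hS, hadm, hr1, hr, hs1, hs, hpos⟩ := hw
    exact Or.inl (Or.inl (Or.inl ⟨p, pp, r, s, hp, hppp, hS, hadm, hr1, hr, hs1, hs, hpos,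
      ite_mul_eq_or twice _⟩))
  | w3 p pp n₁ n₂ m₁ m₂ twice =>
    simp only [KacxIndex.adm, decide_eq_true_eq] at hw
    obtain ⟨hp, hppp, hS, hcop, hn1, hn2, hn, hm1, hm2, hm, hpos⟩ := hw
    exact Or.inl (Or.inl (Or.inr ⟨p, pp, n₁, n₂, m₁, m₂, hp, hppp, hS, hcop, hn1, hn2, hn, hm1, hm2, hm,
      hpos, ite_mul_eq_or twice _⟩))

/-- Index witnesses certify `KACX` membership of a whole list: if `W.map value = L` and every index of `W`
is admissible, every entry of `L` is a member of `kacxFamily`. [folklore] -/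
theorem mem_kacxFamily_of_witnesses (L : List ℚ) (W : List KacxIndex) (hmap : W.map KacxIndex.value = L)
    (hadm : W.all KacxIndex.adm = true) : ∀ v ∈ L, v ∈ kacxFamily := by
  intro v hv
  rw [← hmap, List.mem_map] at hv
  obtain ⟨w, hw, rfl⟩ := hv
  exact w.value_mem_kacxFamily (List.all_eq_true.mp hadm w hw)

/-! ### Sanity checks: the census variants agree with the originals on the 2D-control windows -/

/-- `SU(2)_k` census checker on `[1/8 − 10⁻⁶, 1/8 + 10⁻⁶]`: accepts `[1/8]`, rejects `[]` (as
`su2Excluded`, cf. `ExclusionSentencesControl2DKacx`). [folklore] -/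
theorem su2ExcludedC_control :
    su2ExcludedC 40 (1 / 8 - 1 / 10 ^ 6) (1 / 8 + 1 / 10 ^ 6) [1 / 8] = true ∧
      su2ExcludedC 40 (1 / 8 - 1 / 10 ^ 6) (1 / 8 + 1 / 10 ^ 6) [] = false := by
  decide +kernel

/-- `KAC` census checker on `[1/8 − 10⁻⁶, 1/8 + 10⁻⁶]`: accepts `[1/8]`, rejects `[]` (as `kacExcluded`,
cf. `ExclusionSentencesControl2D`). [folklore] -/
theorem kacExcludedC_control :
    kacExcludedC 24 8 (1 / 8 - 1 / 10 ^ 6) (1 / 8 + 1 / 10 ^ 6) [1 / 8] = true ∧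
      kacExcludedC 24 8 (1 / 8 - 1 / 10 ^ 6) (1 / 8 + 1 / 10 ^ 6) [] = false := by
  decide +kernel

end Summit.CriticalPhenomena.Ising3D
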